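import Summits.AtomisticToContinuum.FouriersLaw.Theorems.HiddenChargeMazurOddChargeAlgebraDefs

/-!
# Odd conservation laws of the pinned anharmonic chain — toolkit C

Elementary calculus in the chain algebra `𝓡 = ℝ[q_x, p_x : x ∈ ℤ]` used by the refutation
of `HiddenChargeMazur.OddChargeExists`:

* the substitutions `fuse k` (`q_k ↦ q_{k+1}`) and `shear k s` (`q_k ↦ q_k + s q_{k+1}`) on
  generators, and the kernel lemma `fuse k f = 0 → gam k ∣ f` (conjugate by the shear to
  `q_k ∣ f`);
* Euler's identity on a finite set of variables and the rigidity
  "homogeneous of degree `≥ 2` with all second partials zero ⇒ `0`";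
* the calculus of the bond differences `gam j = q_j - q_{j+1}` and of
  `prodsq s = ∏_{j∈s} gam j ²` (partial derivatives, `killVar`, `shift`, interval splitting);
* nonvanishing of `gam`, `prodsq`, `cub (q_i) (q_j)`, `clashQuad` by evaluation.

[folklore]
-/

noncomputable section

open MvPolynomial Finsupp
open scoped BigOperators

namespace Summit.AtomisticToContinuum.FouriersLaw.Theorems.OddChargeAlgebra

/-! ### Generic helpers -/

/-- An `aeval` that fixes every variable occurring in `f` fixes `f`. [folklore] -/
private theorem aeval_eq_self_of_forall_mem_vars' {g : Var → R} {f : R}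
    (h : ∀ i ∈ f.vars, g i = X i) : aeval g f = f := by
  change (aeval g).toRingHom f = RingHom.id _ f
  refine hom_congr_vars ?_ (fun i hi _ => ?_) rfl
  · ext1 c
    simp
  · simp [h i hi]

/-- Over `ℝ`, `∂_i f = 0` means that `f` does not involve the variable `i`. [folklore] -/
private theorem notMem_vars_of_pderiv_eq_zero' {i : Var} {f : R} (h : pderiv i f = 0) :
    i ∉ f.vars := by
  classical
  intro hi
  obtain ⟨d, hd, hid⟩ := (mem_vars_iff_mem_support (p := f) i).1 hi
  have h1 : coeff (d - Finsupp.single i 1) (pderiv i f) = 0 := by rw [h, coeff_zero]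
  have hle : Finsupp.single i 1 ≤ d :=
    Finsupp.single_le_iff.2 (Nat.one_le_iff_ne_zero.2 (Finsupp.mem_support_iff.1 hid))
  rw [coeff_pderiv, tsub_add_cancel_of_le hle] at h1
  rcases mul_eq_zero.1 h1 with h2 | h2
  · exact (MvPolynomial.mem_support_iff.1 hd) h2
  · exact Nat.cast_add_one_ne_zero _ h2

/-! ### `fuse` and `shear` on generators -/

/-- `fuse k (q_k) = q_{k+1}`. [folklore] -/
theorem fuse_X_inl_self (k : ℤ) : fuse k (X (Sum.inl k) : R) = X (Sum.inl (k + 1)) := by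
  simp [fuse]

/-- `fuse k` fixes every other variable. [folklore] -/
theorem fuse_X_of_ne {k : ℤ} {w : Var} (h : w ≠ Sum.inl k) : fuse k (X w : R) = X w := by
  simp [fuse, h]

/-- `fuse k` fixes constants. [folklore] -/
theorem fuse_C (k : ℤ) (c : ℝ) : fuse k (C c : R) = C c := by
  simp [fuse]

/-- `fuse k` kills `gam k = q_k - q_{k+1}`. [folklore] -/
theorem fuse_gam_self (k : ℤ) : fuse k (gam k) = 0 := by
  simp [fuse, gam]

/-- `fuse k` fixes `gam j` for `j ∉ {k - 1, k}`. [folklore] -/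
theorem fuse_gam_of_ne {k j : ℤ} (h1 : j ≠ k) (h2 : j + 1 ≠ k) : fuse k (gam j) = gam j := by
  simp [fuse, gam, h1, h2]

/-- `fuse k` fixes a polynomial free of `q_k`. [folklore] -/
theorem fuse_eq_self_of_pderiv {k : ℤ} {f : R} (h : pderiv (Sum.inl k) f = 0) : fuse k f = f := by
  refine aeval_eq_self_of_forall_mem_vars' fun i hi => ?_
  have : i ≠ Sum.inl k := fun e => notMem_vars_of_pderiv_eq_zero' h (e ▸ hi)
  simp [this]

/-- `shear k s (q_k) = q_k + s q_{k+1}`. [folklore] -/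
theorem shear_X_inl_self (k : ℤ) (s : ℝ) :
    shear k s (X (Sum.inl k) : R) = X (Sum.inl k) + C s * X (Sum.inl (k + 1)) := by
  simp [shear]

/-- `shear k s` fixes every other variable. [folklore] -/
theorem shear_X_of_ne {k : ℤ} (s : ℝ) {w : Var} (h : w ≠ Sum.inl k) :
    shear k s (X w : R) = X w := by
  simp [shear, h]

/-- `shear k s ∘ shear k (-s) = id`. [folklore] -/
theorem shear_comp_shear_neg (k : ℤ) (s : ℝ) (f : R) : shear k s (shear k (-s) f) = f := by
  have hk : (Sum.inl (k + 1) : Var) ≠ Sum.inl k := by simp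
  have : (shear k s).comp (shear k (-s)) = AlgHom.id ℝ R := by
    refine MvPolynomial.algHom_ext fun w => ?_
    by_cases hw : w = Sum.inl k
    · subst hw
      simp only [AlgHom.comp_apply, shear_X_inl_self, map_add, map_mul, AlgHom.id_apply,
        shear_X_of_ne _ hk, algHom_C, algebraMap_eq, map_neg]
      ring
    · simp [shear_X_of_ne _ hw]
  exact AlgHom.congr_fun this f

/-- `killVar (q_k)` fixes the variables other than `q_k` and kills `q_k`. [folklore] -/
private theorem killVar_X' (v w : Var) : killVar v (X w : R) = if w = v then 0 else X w := by
  simp [killVar]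

/-- `killVar (q_k) ∘ shear k 1 = fuse k`. [folklore] -/
theorem killVar_shear_one (k : ℤ) (f : R) : killVar (Sum.inl k) (shear k 1 f) = fuse k f := by
  have hk : (Sum.inl (k + 1) : Var) ≠ Sum.inl k := by simp
  have : (killVar (Sum.inl k)).comp (shear k 1) = fuse k := by
    refine MvPolynomial.algHom_ext fun w => ?_
    by_cases hw : w = Sum.inl k
    · subst hw
      simp [shear_X_inl_self, killVar_X', fuse_X_inl_self, hk]
    · simp [shear_X_of_ne _ hw, killVar_X', fuse_X_of_ne hw, hw]
  exact AlgHom.congr_fun this f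

/-! ### The kernel of `fuse k` is the ideal `(gam k)` -/

/-- Private copy of the toolkit fact `killVar v F = 0 → X v ∣ F`: the remainder of `F` modulo
`X v` is free of `X v`, hence fixed by `killVar v`, hence equal to `killVar v F = 0`. [folklore] -/
private theorem exists_eq_X_mul_of_killVar' (v : Var) (F : R) (h : killVar v F = 0) :
    ∃ g : R, F = X v * g := by
  classical
  set q := MvPolynomial.divMonomial F (Finsupp.single v 1)
  set r := MvPolynomial.modMonomial F (Finsupp.single v 1)
  have hF : X v * q + r = F := divMonomial_add_modMonomial_single F v
  have hrr : killVar v r = r := by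
    refine aeval_eq_self_of_forall_mem_vars' fun i hi => ?_
    have hiv : i ≠ v := by
      rintro rfl
      obtain ⟨d, hd, hid⟩ := (mem_vars_iff_mem_support (p := r) i).1 hi
      have hle : Finsupp.single i 1 ≤ d :=
        Finsupp.single_le_iff.2 (Nat.one_le_iff_ne_zero.2 (Finsupp.mem_support_iff.1 hid))
      exact (MvPolynomial.mem_support_iff.1 hd) (coeff_modMonomial_of_le F hle)
    simp [hiv]
  have hkr : killVar v F = r := by
    rw [← hF, map_add, map_mul, killVar_X', if_pos rfl, zero_mul, zero_add, hrr]
  refine ⟨q, ?_⟩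
  rw [hkr] at h
  rw [← hF, h, add_zero]

/-- `shear k (-1)` maps `q_k` to `gam k`. [folklore] -/
theorem shear_neg_one_X_inl_self (k : ℤ) : shear k (-1) (X (Sum.inl k) : R) = gam k := by
  rw [shear_X_inl_self, gam, map_neg, map_one]
  ring

/-- **Kernel of `fuse`.** If `f` vanishes on the diagonal `q_k = q_{k+1}` then
`gam k = q_k - q_{k+1}` divides `f`: conjugate by the shear `q_k ↦ q_k ± q_{k+1}` to
`killVar (q_k) F = 0 → q_k ∣ F`. [folklore] -/
theorem exists_eq_gam_mul_of_fuse_eq_zero :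
    ∀ (k : ℤ) (f : R), fuse k f = 0 → ∃ g : R, f = gam k * g := by
  intro k f h
  rw [← killVar_shear_one] at h
  obtain ⟨g', hg'⟩ := exists_eq_X_mul_of_killVar' _ _ h
  refine ⟨shear k (-1) g', ?_⟩
  have : f = shear k (-1) (shear k 1 f) := by
    simpa using (shear_comp_shear_neg k (-1) f).symm
  rw [this, hg', map_mul, shear_neg_one_X_inl_self]

/-- Supported refinement of the kernel lemma: if moreover `f` only involves variables of
`S ∋ q_k, q_{k+1}` then the quotient may be taken in the same variables. [folklore] -/
theorem exists_eq_gam_mul_of_fuse_eq_zero_of_mem {S : Set Var} {k : ℤ} {f : R}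
    (hS : Sum.inl k ∈ S) (hS' : Sum.inl (k + 1) ∈ S) (hf : f ∈ supported ℝ S)
    (h : fuse k f = 0) :
    ∃ g : R, g ∈ supported ℝ S ∧ f = gam k * g := by
  classical
  obtain ⟨g, hg⟩ := exists_eq_gam_mul_of_fuse_eq_zero k f h
  -- project onto the variables of `S`
  let π : R →ₐ[ℝ] R := aeval fun w => if w ∈ S then X w else 0
  have hπf : π f = f := aeval_ite_mem_eq_self f (mem_supported.1 hf)
  have hπg : π (gam k) = gam k := by simp [π, gam, hS, hS']
  have hrange : π g ∈ supported ℝ S := by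
    rw [supported_eq_range_rename]
    let ι : R →ₐ[ℝ] MvPolynomial S ℝ :=
      aeval fun w => if h : w ∈ S then X ⟨w, h⟩ else 0
    have hcomp : (rename ((↑) : S → Var)).comp ι = π := by
      refine MvPolynomial.algHom_ext fun w => ?_
      by_cases hw : w ∈ S <;> simp [ι, π, hw]
    exact ⟨ι g, by simpa using AlgHom.congr_fun hcomp g⟩
  exact ⟨π g, hrange, by rw [← hπf, hg, map_mul, hπg]⟩

/-! ### Euler's identity on finitely many variables and the Killing rigidity -/

/-- Weighted Euler identity, summed over any finite set of variables containing those of `f`: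
`Σ_v w_v X_v ∂_v f = n f` for `f` weighted homogeneous of weight `n`. [folklore] -/
theorem sum_weight_X_mul_pderiv_of_isWeightedHomogeneous {w : Var → ℕ} {f : R} {n : ℕ}
    (hf : IsWeightedHomogeneous w f n) {s : Finset Var} (hs : f.vars ⊆ s) :
    ∑ v ∈ s, (w v : R) * (X v * pderiv v f) = (n : R) * f := by
  classical
  have key : ∀ m ∈ f.support,
      ∑ v ∈ s, (w v : R) * (X v * pderiv v (monomial m (coeff m f)))
        = (n : R) * monomial m (coeff m f) := by
    intro m hm
    simp_rw [X_mul_pderiv_monomial, nsmul_eq_mul, ← mul_assoc, ← Finset.sum_mul]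
    congr 1
    have hwt : weight w m = n := hf (MvPolynomial.mem_support_iff.mp hm)
    rw [weight_apply, Finsupp.sum] at hwt
    have hsub : m.support ⊆ s := fun i hi =>
      hs ((mem_vars_iff_mem_support (p := f) i).2 ⟨m, hm, hi⟩)
    rw [← hwt, Finset.sum_subset hsub (f := fun i => m i • w i)
      (by intro v _ hv; simp [Finsupp.notMem_support_iff.mp hv])]
    push_cast
    exact Finset.sum_congr rfl fun v _ => by simp only [smul_eq_mul, Nat.cast_mul]; ring
  calc ∑ v ∈ s, (w v : R) * (X v * pderiv v f)
      = ∑ v ∈ s, (w v : R) *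
          (X v * pderiv v (∑ m ∈ f.support, monomial m (coeff m f))) := by
        rw [← f.as_sum]
    _ = ∑ v ∈ s, ∑ m ∈ f.support,
          (w v : R) * (X v * pderiv v (monomial m (coeff m f))) := by
        simp_rw [map_sum, Finset.mul_sum]
    _ = ∑ m ∈ f.support, ∑ v ∈ s, (w v : R) * (X v * pderiv v (monomial m (coeff m f))) :=
        Finset.sum_comm
    _ = ∑ m ∈ f.support, (n : R) * monomial m (coeff m f) := Finset.sum_congr rfl key
    _ = (n : R) * f := by rw [← Finset.mul_sum, ← f.as_sum]

/-- Euler's identity, summed over any finite set of variables containing those of `f`: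
`Σ_v X_v ∂_v f = n f` for `f` homogeneous of degree `n`. [folklore] -/
theorem sum_X_mul_pderiv_of_isHomogeneous {f : R} {n : ℕ} (hf : f.IsHomogeneous n)
    {s : Finset Var} (hs : f.vars ⊆ s) : ∑ v ∈ s, X v * pderiv v f = (n : R) * f := by
  have := sum_weight_X_mul_pderiv_of_isWeightedHomogeneous hf hs
  simpa using this

/-- A homogeneous polynomial of positive degree all of whose first partials vanish is zero.
[folklore] -/
theorem eq_zero_of_isHomogeneous_of_pderiv {f : R} {n : ℕ} (hf : f.IsHomogeneous n) (hn : n ≠ 0)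
    (h : ∀ v : Var, pderiv v f = 0) : f = 0 := by
  have e := sum_X_mul_pderiv_of_isHomogeneous hf (subset_refl f.vars)
  simp only [h, mul_zero, Finset.sum_const_zero] at e
  exact (mul_eq_zero.1 e.symm).resolve_left (Nat.cast_ne_zero.2 hn)

/-- **Killing rigidity.** A homogeneous polynomial of degree `n ≥ 2` all of whose second partial
derivatives vanish is zero (Euler's identity applied to `∂_w f`, then to `f`). [folklore] -/
theorem eq_zero_of_isHomogeneous_of_pderiv_pderiv :
    ∀ (f : R) (n : ℕ), f.IsHomogeneous n → 2 ≤ n →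
      (∀ v w : Var, pderiv v (pderiv w f) = 0) → f = 0 := by
  intro f n hf hn h
  refine eq_zero_of_isHomogeneous_of_pderiv hf (by omega) fun w => ?_
  exact eq_zero_of_isHomogeneous_of_pderiv hf.pderiv (by omega) fun v => h v w

/-! ### Calculus of `gam` and `prodsq` -/

/-- `prodsq ∅ = 1`. [folklore] -/
theorem prodsq_empty : prodsq ∅ = 1 := by simp [prodsq]

/-- `prodsq (insert j s) = gam j ² * prodsq s` for `j ∉ s`. [folklore] -/
theorem prodsq_insert {j : ℤ} {s : Finset ℤ} (h : j ∉ s) :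
    prodsq (insert j s) = gam j ^ 2 * prodsq s := by
  simp [prodsq, Finset.prod_insert h]

/-- `prodsq [a, b+1) = prodsq [a, b) * gam b ²` for `a ≤ b`. [folklore] -/
theorem prodsq_Ico_succ {a b : ℤ} (h : a ≤ b) :
    prodsq (Finset.Ico a (b + 1)) = prodsq (Finset.Ico a b) * gam b ^ 2 := by
  rw [← Finset.insert_Ico_right_eq_Ico_add_one h, prodsq_insert Finset.right_notMem_Ico, mul_comm]

/-- `prodsq [a, b) = prodsq [a, m) * prodsq [m, b)` for `a ≤ m ≤ b`. [folklore] -/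
theorem prodsq_Ico_split {a m b : ℤ} (h1 : a ≤ m) (h2 : m ≤ b) :
    prodsq (Finset.Ico a b) = prodsq (Finset.Ico a m) * prodsq (Finset.Ico m b) := by
  rw [prodsq, prodsq, prodsq, ← Finset.prod_union (Finset.Ico_disjoint_Ico_consecutive a m b),
    Finset.Ico_union_Ico_eq_Ico h1 h2]

/-- `prodsq [a, b) = 1` for `b ≤ a`. [folklore] -/
theorem prodsq_Ico_eq_one {a b : ℤ} (h : b ≤ a) : prodsq (Finset.Ico a b) = 1 := by
  rw [Finset.Ico_eq_empty (not_lt.2 h), prodsq_empty]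

/-- `∂_{q_i} γ_j` (`= 1` if `i = j`, `-1` if `i = j+1`, `0` otherwise). [folklore] -/
theorem pderiv_inl_gam (i j : ℤ) :
    pderiv (Sum.inl i) (gam j) = if i = j then 1 else if i = j + 1 then -1 else 0 := by
  classical
  simp only [gam, map_sub, pderiv_X, Pi.single_apply, Sum.inl.injEq]
  by_cases h1 : i = j
  · subst h1; simp
  · by_cases h2 : i = j + 1
    · subst h2; simp
    · simp [h1, h2, Ne.symm h1, Ne.symm h2]

/-- `∂_{q_j} γ_j = 1`. [folklore] -/
theorem pderiv_inl_gam_self (j : ℤ) : pderiv (Sum.inl j) (gam j) = 1 := by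
  simp [pderiv_inl_gam]

/-- `∂_{q_{j+1}} γ_j = -1`. [folklore] -/
theorem pderiv_inl_gam_succ (j : ℤ) : pderiv (Sum.inl (j + 1)) (gam j) = -1 := by
  simp [pderiv_inl_gam]

/-- `∂_{q_i} γ_j = 0` for `i ∉ {j, j+1}`. [folklore] -/
theorem pderiv_inl_gam_of_ne {i j : ℤ} (h1 : i ≠ j) (h2 : i ≠ j + 1) :
    pderiv (Sum.inl i) (gam j) = 0 := by
  simp [pderiv_inl_gam, h1, h2]

/-- `∂_{p_i} γ_j = 0`. [folklore] -/
theorem pderiv_inr_gam (i j : ℤ) : pderiv (Sum.inr i) (gam j) = 0 := by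
  classical
  simp [gam, pderiv_X]

/-- `∂_{q_i} prodsq s = 0` when `i, i-1 ∉ s`. [folklore] -/
theorem pderiv_inl_prodsq_eq_zero {i : ℤ} {s : Finset ℤ} (h1 : i ∉ s) (h2 : i - 1 ∉ s) :
    pderiv (Sum.inl i) (prodsq s) = 0 := by
  classical
  induction s using Finset.induction_on with
  | empty => simp [prodsq_empty]
  | insert j s hj ih =>
    have h1' : i ≠ j := fun e => h1 (e ▸ Finset.mem_insert_self _ _)
    have h2' : i ≠ j + 1 := fun e => h2 (by rw [e]; simp)
    rw [prodsq_insert hj, pderiv_mul, pderiv_pow, pderiv_inl_gam_of_ne h1' h2',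
      ih (fun h => h1 (Finset.mem_insert_of_mem h)) (fun h => h2 (Finset.mem_insert_of_mem h))]
    ring

/-- `∂_{p_i} prodsq s = 0`. [folklore] -/
theorem pderiv_inr_prodsq (i : ℤ) (s : Finset ℤ) : pderiv (Sum.inr i) (prodsq s) = 0 := by
  classical
  induction s using Finset.induction_on with
  | empty => simp [prodsq_empty]
  | insert j s hj ih => rw [prodsq_insert hj, pderiv_mul, pderiv_pow, pderiv_inr_gam, ih]; ring

/-- `∂_{q_y} (γ_{y-1}² γ_y²) = 2 γ_{y-1} γ_y (γ_{y-1} - γ_y)`. [folklore] -/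
theorem pderiv_inl_gam_sq_mul_gam_sq (y : ℤ) :
    pderiv (Sum.inl y) (gam (y - 1) ^ 2 * gam y ^ 2)
      = 2 * gam (y - 1) * gam y * (gam (y - 1) - gam y) := by
  have h1 : pderiv (Sum.inl y) (gam (y - 1)) = -1 := by
    have := pderiv_inl_gam_succ (y - 1)
    rwa [sub_add_cancel] at this
  rw [pderiv_mul, pderiv_pow, pderiv_pow, h1, pderiv_inl_gam_self]
  ring

/-- `killVar (q_i)` fixes `γ_j` for `i ∉ {j, j+1}`. [folklore] -/
theorem killVar_inl_gam_of_ne {i j : ℤ} (h1 : i ≠ j) (h2 : i ≠ j + 1) :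
    killVar (Sum.inl i) (gam j) = gam j := by
  simp [gam, killVar_X', Ne.symm h1, Ne.symm h2]

/-- `killVar (q_i)` fixes `prodsq s` when `i, i-1 ∉ s`. [folklore] -/
theorem killVar_inl_prodsq_eq_self {i : ℤ} {s : Finset ℤ} (h1 : i ∉ s) (h2 : i - 1 ∉ s) :
    killVar (Sum.inl i) (prodsq s) = prodsq s := by
  rw [prodsq, map_prod]
  refine Finset.prod_congr rfl fun j hj => ?_
  have h1' : i ≠ j := fun e => h1 (e ▸ hj)
  have h2' : i ≠ j + 1 := fun e => h2 (by rw [e]; simpa using hj)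
  rw [map_pow, killVar_inl_gam_of_ne h1' h2']

/-- `shift γ_j = γ_{j+1}`. [folklore] -/
private theorem shift_gam' (j : ℤ) : shift (gam j) = gam (j + 1) := by
  simp [shift, shiftBy, transl, gam]

/-- `shift (prodsq [a, b)) = prodsq [a+1, b+1)`. [folklore] -/
private theorem shift_prodsq_Ico' (a b : ℤ) :
    shift (prodsq (Finset.Ico a b)) = prodsq (Finset.Ico (a + 1) (b + 1)) := by
  rw [prodsq, prodsq, map_prod]
  simp_rw [map_pow, shift_gam']
  exact Finset.prod_Ico_add' (fun j => gam j ^ 2) a b 1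

/-- `fuse k (γ_k ²) = 0`. [folklore] -/
theorem fuse_gam_sq_self (k : ℤ) : fuse k (gam k ^ 2) = 0 := by
  rw [map_pow, fuse_gam_self, zero_pow two_ne_zero]

/-! ### Nonvanishing -/

/-- A polynomial with a nonzero value is nonzero. [folklore] -/
theorem ne_zero_of_eval_ne_zero {f : R} (φ : Var → ℝ) (h : MvPolynomial.eval φ f ≠ 0) :
    f ≠ 0 := by
  rintro rfl
  exact h (map_zero _)

/-- `q_i ≠ 0`. [folklore] -/
theorem X_inl_ne_zero (i : ℤ) : (X (Sum.inl i) : R) ≠ 0 := X_ne_zero _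

/-- `γ_j ≠ 0`. [folklore] -/
theorem gam_ne_zero (j : ℤ) : gam j ≠ 0 := by
  refine ne_zero_of_eval_ne_zero (fun v => if v = Sum.inl j then 1 else 0) ?_
  simp [gam]

/-- `prodsq s ≠ 0`. [folklore] -/
theorem prodsq_ne_zero (s : Finset ℤ) : prodsq s ≠ 0 :=
  Finset.prod_ne_zero_iff.2 fun j _ => pow_ne_zero _ (gam_ne_zero j)

/-- `cub (q_i) (q_j) ≠ 0` for `i ≠ j`. [folklore] -/
theorem cub_inl_ne_zero {i j : ℤ} (h : i ≠ j) :
    cub (X (Sum.inl i)) (X (Sum.inl j)) ≠ (0 : R) := by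
  refine ne_zero_of_eval_ne_zero (fun v => if v = Sum.inl i then 1 else 0) ?_
  simp [cub, Ne.symm h]

/-- The clash polynomial is nonzero (its value at `q_{D-1} = q_D = 0`, `q_{D+1} = 1` is `-2`).
[folklore] -/
theorem clashQuad_ne_zero (D : ℤ) : clashQuad D ≠ 0 := by
  refine ne_zero_of_eval_ne_zero (fun v => if v = Sum.inl (D + 1) then 1 else 0) ?_
  have h : D - 1 ≠ D + 1 := by omega
  simp [clashQuad, h]

/-- Cancellation of a nonzero polynomial factor against a scalar:
`C c * f = 0`, `f ≠ 0 ⇒ c = 0`. [folklore] -/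
theorem eq_zero_of_C_mul_eq_zero {c : ℝ} {f : R} (hf : f ≠ 0) (h : C c * f = 0) : c = 0 := by
  rcases mul_eq_zero.1 h with h' | h'
  · exact (C_eq_zero (σ := Var)).1 h'
  · exact absurd h' hf

end Summit.AtomisticToContinuum.FouriersLaw.Theorems.OddChargeAlgebra

end
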